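import Summits.ValiantsHypothesis.ValiantsHypothesis.Theorems.KPlusLogSqLawOctaveIntegerisation
import Summits.ValiantsHypothesis.ValiantsHypothesis.Theorems.KPlusLogSqLawOctaveRootNearBreakpoint

/-!
# Route «KPlusLogSqLaw», octave line — file 7/7: the RUNG `shallowOctaveLifting_proof : ShallowOctaveLifting`, assembled from its three proved pieces

HONEST FRAMING.  Octave line of ideator seat val-idea-6 (crux-idea `octave-lifting` on stmt-ValiantsHypothesis-19561, critic-1 PASS 2026-08-27), published as `Cruxes/WeakLifting/Lines/octave.lean`; landed in Theorems shape by prover seat val-width-19561-oc1 (`--supports stmt-ValiantsHypothesis-19561`).  Conjecture B (`KPlusLogSqLaw`), `TropicalB` (stmt-19771), `WeakLifting` (stmt-19561), `MatrixDescartes` (stmt-18050) and the octave statements `OctaveWeakLifting` / `OctaveKLaw` / `OctaveMatrixDescartes` are OPEN and DEFINED, never asserted; nothing in this file proves any of them, and VP ≠ VNP is not moved.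

This file: `shallowOctaveLifting_proof` = `shallowOctaveLifting_of designPiecesBound_proof rootNearBreakpoint_proof cellCount_proof` — `TropRowD m K n` ⇒ every real (m,K) pencil of cancellation depth `≤ Δ` has its nonzero real roots in at most `(2(m(⌊log₂ mK⌋+1)+Δ)+3)(n+1)` dyadic octaves (symmetry unused).  A depth-BOUNDED sector of the open, depth-free `OctaveWeakLifting`; not the crux.
-/

set_option linter.dupNamespace false
set_option autoImplicit false

namespace Summit.ValiantsHypothesis.ValiantsHypothesis.Theorems.KPlusLogSqLaw.Octave

open Polynomial Finset
open scoped BigOperators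
open Summit.ValiantsHypothesis.ValiantsHypothesis.Theorems.LacunarySymmetroidMatrixDescartes (RealRootLawAt KPlusLogSqLaw)
open Summit.ValiantsHypothesis.ValiantsHypothesis.Theses.LacunarySymmetroid (MatrixDescartes PencilTransfer ThetaWitness)
open Summit.ValiantsHypothesis.ValiantsHypothesis.Theses.KPlusLogSqLaw (TropicalB WeakLifting)

section Depth

/-- **the rung** `ShallowOctaveLifting`, PROVED: assembled from its three proved pieces. -/
theorem shallowOctaveLifting_proof : ShallowOctaveLifting :=
  shallowOctaveLifting_of designPiecesBound_proof rootNearBreakpoint_proof cellCount_proof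

end Depth

end Summit.ValiantsHypothesis.ValiantsHypothesis.Theorems.KPlusLogSqLaw.Octave
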